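import Summits.BirchSwinnertonDyer.Rank1Residual.Additive.TameBranchOfTwistPartner
import HarnessLib

/-!
# Class N10, tame branch: the ORDER of the Teichmüller power `ω^{t(E,p)}` is the tame defect `e`,
# and the bridge `OrdinaryTwistPartnerAt ⟹ IsTameBranchOf` ON THE CENSUS LOCUS X4-3 with the order
# binder of `TameBranchRatCharEqAt` discharged (cell `b2b-bsdres`, lane CLASS-CLOSURE, seat cc-typer-2;
# team n1011 lead GEN 4 R5-10; census-ctyper1 H-2)

HONEST FRAMING (cell `b2b-bsdres`, run/shared/lean/b2b/bsd-rank1-residual/, verbatim in every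
file): the goal of the cell is to DELETE the COMBINATION-SHAPED residual classes of the
Birch–Swinnerton-Dyer formula for ALL analytic-rank `≤ 1` elliptic curves over `ℚ` — "full BSD
formula for every rank `≤ 1` curve in class `C`" assembled STRICTLY from published theorems — so
that the rank-`≤ 1` remainder becomes exactly the CONSTRUCTION-SHAPED classes, which are TYPED
(missing-input `Prop`s), NOT attempted. This is not "finishing BSD". Lane CLASS-CLOSURE
(coordinator ruling 2026-08-21T04:07Z): research routes, no claim beyond the stated classes;
census output = EVIDENCE / conjecture items with held-out validation, NEVER a Literature fact;
the class N10 stays CONSTRUCTION-shaped (RESIDUAL-MAP §I); NOTHING is booked. THEOREMS ONLY; no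
definition, no named fact, no conjecture node; labels / RESIDUAL-MAP marks UNCHANGED.

## What

* §5a `orderOf_eq_of_isTeichmullerPow`: a character `χ` of `ℤ/p` with values in `ℚ_p` which IS the
  Teichmüller power `ω^t` in census-ctyper1's sense (`CensusX43.IsTeichmullerPow χ t`:
  `‖χ(a) − a^t‖ < 1`) has order EXACTLY `(p − 1)/gcd(p − 1, t)`: `χ(a)ⁿ = 1 ⟺ a^{tn} ≡ 1 (mod p)`
  (values are `(p−1)`-th roots of unity, and a root of unity of order prime to `p` in the residue
  disc of `1` is `1` — `eq_one_of_pow_eq_one_of_norm_sub_one_lt_one`, the geometric-series Hensel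
  step), then a generator of `(ℤ/p)ˣ`; the `ℂ_p`-valued copy `ι∘χ` has the same order
  (`orderOf_ringHomComp_padicComplex`).
* §5b `div_gcd_ordinaryTeichmullerExponent_eq`: on the locus `e ∈ {3,4,6}`, `e ∣ p − 1`
  (`e = 12/gcd(12, v_p Δ_min)`, `t(E,p) = v_p(Δ_min)(p−1)/12`): `(p − 1)/gcd(p − 1, t(E,p)) = e`
  (the arithmetic of `CensusX43.not_dvd_ordinaryTeichmullerExponent`, sharpened from "`≠ 1`" to
  "order exactly `e`"). Hence `orderOf (ι∘ω^{t(E,p)}) = e = tameDefect E p` on (G-ord) rows — the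
  order binder of `TameBranchRatCharEqAt` (`TameBranchLower.lean`).
* §5c `exists_isTameBranchOf_of_ordinaryTwistPartnerAt`: on X4-3 (`p ≥ 5`, `SubGord`,
  `e ∈ {3,4,6}`) the census typed input `CensusX43.OrdinaryTwistPartnerAt W p` yields, for the
  newform `f` of `E` and `χ = ω^{t(E,p)}`, a tuple `(ι∘χ, ã, B)` with `‖ã‖ = 1`,
  `orderOf (ι∘χ) = tameDefect E p`, `IsTameBranchOf f p (ι∘χ) ã B` and the integrality transfer —
  EXACTLY the binders of `TameBranchRatCharEqAt W p`. The joins with the typed main conjecture and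
  with the `T = 0` UPPER/LOWER chains are in `Additive/TameBranchCensusJoin.lean`. Nothing booked.

References: Mazur–Tate–Teitelbaum, Invent. Math. 84 (1986) §I.13 [MazurTateTeitelbaum1986Invent];
Washington, *Introduction to cyclotomic fields*, GTM 83, §5.1 (Teichmüller character); Delbourgo,
Compositio Math. 113 (1998) §1.5 [Delbourgo1998]; HOME/class-closure/typer-2/T-c4-ANSWER.md.
-/

noncomputable section

open scoped Classical MatrixGroups ModularForm NumberField

open CongruenceSubgroup WeierstrassCurve NumberField Literature.NumberTheory.EllipticCurves
  Literature.NumberTheory.EllipticCurves.ModularForms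
  Literature.NumberTheory.EllipticCurves.Rank1Residual
  Literature.NumberTheory.EllipticCurves.Rank1Residual.Typed
  IsDedekindDomain

namespace Summit.BirchSwinnertonDyer.Rank1Residual.Additive

/-! ### §5a The order of a Teichmüller power -/

section TeichOrder

variable {p : ℕ} [hp : Fact p.Prime]

/-- Powers of `p`-adically close elements of the unit disc stay close:
`‖u‖, ‖v‖ ≤ 1`, `‖u − v‖ < 1` ⟹ `‖uⁿ − vⁿ‖ < 1`. [folklore] -/
theorem norm_pow_sub_pow_lt_one {u v : ℚ_[p]} (hu : ‖u‖ ≤ 1) (hv : ‖v‖ ≤ 1) (h : ‖u - v‖ < 1)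
    (n : ℕ) : ‖u ^ n - v ^ n‖ < 1 := by
  induction n with
  | zero => simp
  | succ n ih =>
    rw [show u ^ (n + 1) - v ^ (n + 1) = u * (u ^ n - v ^ n) + (u - v) * v ^ n by ring]
    refine (IsUltrametricDist.norm_add_le_max _ _).trans_lt (max_lt ?_ ?_)
    · rw [norm_mul]
      exact (mul_le_of_le_one_left (norm_nonneg _) hu).trans_lt ih
    · rw [norm_mul, norm_pow]
      exact (mul_le_of_le_one_right (norm_nonneg _) (pow_le_one₀ (norm_nonneg _) hv)).trans_lt h

/-- **Hensel for roots of unity of order prime to `p`**: `ζ^k = 1`, `p ∤ k`, `‖ζ − 1‖ < 1` ⟹ `ζ = 1`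
(`0 = ζ^k − 1 = (ζ − 1)(1 + ζ + ⋯ + ζ^{k−1})` and the second factor is `≡ k ≢ 0`). [folklore] -/
theorem eq_one_of_pow_eq_one_of_norm_sub_one_lt_one {ζ : ℚ_[p]} {k : ℕ} (hk : ¬ p ∣ k)
    (hζ : ζ ^ k = 1) (h1 : ‖ζ - 1‖ < 1) : ζ = 1 := by
  have hk0 : k ≠ 0 := fun h ↦ hk (h ▸ dvd_zero p)
  have hζ1 : ‖ζ‖ ≤ 1 := by
    rw [show ζ = (ζ - 1) + 1 by ring]
    exact (IsUltrametricDist.norm_add_le_max _ _).trans (max_le h1.le (by rw [norm_one]))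
  have hpow : ∀ i : ℕ, ‖ζ ^ i - 1‖ < 1 := fun i ↦ by
    have h := norm_pow_sub_pow_lt_one hζ1 (le_of_eq norm_one) h1 i
    rwa [one_pow] at h
  have hsmall : ‖∑ i ∈ Finset.range k, (ζ ^ i - 1)‖ < 1 := by
    obtain ⟨i, -, hi⟩ := IsUltrametricDist.exists_norm_finsetSum_le_of_nonempty
      (Finset.nonempty_range_iff.mpr hk0) (fun i ↦ ζ ^ i - 1)
    exact hi.trans_lt (hpow i)
  have hkn : ‖(k : ℚ_[p])‖ = 1 :=
    Padic.norm_natCast_eq_one_iff.mpr ((Nat.Prime.coprime_iff_not_dvd hp.out).mpr hk)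
  have hS : ∑ i ∈ Finset.range k, ζ ^ i = (k : ℚ_[p]) + ∑ i ∈ Finset.range k, (ζ ^ i - 1) := by
    rw [Finset.sum_sub_distrib, Finset.sum_const, Finset.card_range, nsmul_eq_mul, mul_one]
    ring
  have hS1 : ‖∑ i ∈ Finset.range k, ζ ^ i‖ = 1 := by
    have hne : ‖(k : ℚ_[p])‖ ≠ ‖∑ i ∈ Finset.range k, (ζ ^ i - 1)‖ := by
      rw [hkn]; exact (ne_of_gt hsmall)
    rw [hS, IsUltrametricDist.norm_add_eq_max_of_norm_ne_norm hne, hkn, max_eq_left hsmall.le]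
  have hne : ∑ i ∈ Finset.range k, ζ ^ i ≠ 0 := fun h ↦ by
    rw [h, norm_zero] at hS1; exact zero_ne_one hS1
  have hgeom : (∑ i ∈ Finset.range k, ζ ^ i) * (ζ - 1) = 0 := by rw [geom_sum_mul, hζ, sub_self]
  rcases mul_eq_zero.mp hgeom with h | h
  · exact absurd h hne
  · exact sub_eq_zero.mp h

/-- **`(ω^t(a))ⁿ = 1 ⟺ a^{tn} ≡ 1 (mod p)`** for a Teichmüller power `χ = ω^t` (`χ(a) ≡ a^t`,
values `(p−1)`-th roots of unity) and `a ≢ 0`. [folklore] -/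
theorem pow_apply_eq_one_iff_of_isTeichmullerPow {χ : MulChar (ZMod p) ℚ_[p]} {t : ℕ}
    (hχ : CensusX43.IsTeichmullerPow χ t) {a : ZMod p} (ha : a ≠ 0) (n : ℕ) :
    (χ a) ^ n = 1 ↔ a ^ (t * n) = 1 := by
  have hav : ‖(a.val : ℚ_[p])‖ ≤ 1 := by exact_mod_cast Padic.norm_int_le_one (a.val : ℤ)
  have hclose : ‖(χ a) ^ n - ((a.val : ℚ_[p]) ^ t) ^ n‖ < 1 :=
    norm_pow_sub_pow_lt_one (CensusX43.norm_apply_le_one χ a)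
      (by rw [norm_pow]; exact pow_le_one₀ (norm_nonneg _) hav) (hχ a ha) n
  have hcast : ((a.val : ℚ_[p]) ^ t) ^ n = (((a.val : ℤ) ^ (t * n) : ℤ) : ℚ_[p]) := by
    push_cast; rw [pow_mul]
  rw [hcast] at hclose
  have hzmod : (((a.val : ℤ) ^ (t * n) : ℤ) : ZMod p) = a ^ (t * n) := by
    push_cast; rw [ZMod.natCast_zmod_val]
  constructor
  · intro h
    rw [h] at hclose
    have hdvd : (p : ℤ) ∣ 1 - (a.val : ℤ) ^ (t * n) := by
      rw [← Padic.norm_intCast_lt_one_iff]; push_cast at hclose ⊢; exact hclose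
    have h0 := (ZMod.intCast_zmod_eq_zero_iff_dvd _ p).mpr hdvd
    rw [Int.cast_sub, Int.cast_one, hzmod, sub_eq_zero] at h0
    exact h0.symm
  · intro h
    have hdvd : (p : ℤ) ∣ (a.val : ℤ) ^ (t * n) - 1 := by
      rw [← ZMod.intCast_zmod_eq_zero_iff_dvd, Int.cast_sub, Int.cast_one, hzmod, h, sub_self]
    have hlt : ‖((((a.val : ℤ) ^ (t * n) : ℤ)) : ℚ_[p]) - 1‖ < 1 := by
      rw [← Padic.norm_intCast_lt_one_iff] at hdvd; push_cast at hdvd ⊢; exact hdvd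
    have h1 : ‖(χ a) ^ n - 1‖ < 1 := by
      rw [show (χ a) ^ n - 1 = ((χ a) ^ n - (((a.val : ℤ) ^ (t * n) : ℤ) : ℚ_[p])) +
        ((((a.val : ℤ) ^ (t * n) : ℤ) : ℚ_[p]) - 1) by ring]
      exact (IsUltrametricDist.norm_add_le_max _ _).trans_lt (max_lt hclose hlt)
    have hp1 : ¬ p ∣ p - 1 := fun hd ↦ by
      have := Nat.le_of_dvd (by have := hp.out.two_le; omega) hd
      have := hp.out.two_le; omega
    refine eq_one_of_pow_eq_one_of_norm_sub_one_lt_one hp1 ?_ h1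
    rw [← pow_mul, mul_comm, pow_mul, ← map_pow, ZMod.pow_card_sub_one_eq_one ha, map_one, one_pow]

/-- **`(ω^t)ⁿ = 1 ⟺ (p − 1) ∣ t·n`**. [folklore] -/
theorem pow_eq_one_iff_of_isTeichmullerPow {χ : MulChar (ZMod p) ℚ_[p]} {t : ℕ}
    (hχ : CensusX43.IsTeichmullerPow χ t) (n : ℕ) : χ ^ n = 1 ↔ (p - 1) ∣ t * n := by
  haveI : Fact (1 < p) := ⟨hp.out.one_lt⟩
  constructor
  · intro h
    obtain ⟨g, hg⟩ := IsCyclic.exists_ofOrder_eq_natCard (α := (ZMod p)ˣ)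
    rw [Nat.card_eq_fintype_card, ZMod.card_units p] at hg
    have h1 : (χ (g : ZMod p)) ^ n = 1 := by
      rw [← MulChar.pow_apply_coe, h, MulChar.one_apply_coe]
    rw [pow_apply_eq_one_iff_of_isTeichmullerPow hχ (Units.ne_zero g)] at h1
    have hg1 : g ^ (t * n) = 1 := Units.ext (by rw [Units.val_pow_eq_pow_val, h1, Units.val_one])
    rw [← hg]
    exact orderOf_dvd_of_pow_eq_one hg1
  · rintro ⟨k, hk⟩
    refine MulChar.ext fun u ↦ ?_
    rw [MulChar.pow_apply_coe, MulChar.one_apply_coe,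
      pow_apply_eq_one_iff_of_isTeichmullerPow hχ (Units.ne_zero u), hk, pow_mul,
      ZMod.pow_card_sub_one_eq_one (Units.ne_zero u), one_pow]

/-- **The order of `ω^t` is `(p − 1)/gcd(p − 1, t)`.** [folklore] -/
theorem orderOf_eq_of_isTeichmullerPow {χ : MulChar (ZMod p) ℚ_[p]} {t : ℕ}
    (hχ : CensusX43.IsTeichmullerPow χ t) : orderOf χ = (p - 1) / Nat.gcd (p - 1) t := by
  set g : ℕ := Nat.gcd (p - 1) t with hg
  have hg0 : 0 < g := Nat.gcd_pos_of_pos_left _ (by have := hp.out.two_le; omega)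
  set d : ℕ := (p - 1) / g with hd
  set w : ℕ := t / g with hw
  have hdg : d * g = p - 1 := Nat.div_mul_cancel (Nat.gcd_dvd_left _ _)
  have hwg : w * g = t := Nat.div_mul_cancel (Nat.gcd_dvd_right _ _)
  have hcop : Nat.Coprime d w := Nat.coprime_div_gcd_div_gcd hg0
  have hiff : ∀ n : ℕ, χ ^ n = 1 ↔ d ∣ n := by
    intro n
    rw [pow_eq_one_iff_of_isTeichmullerPow hχ]
    have key : p - 1 ∣ t * n ↔ d ∣ w * n := by
      rw [← hdg, ← hwg, show w * g * n = (w * n) * g by ring]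
      exact Nat.mul_dvd_mul_iff_right hg0
    rw [key]
    exact ⟨fun h ↦ hcop.dvd_of_dvd_mul_left h, fun h ↦ dvd_mul_of_dvd_right h w⟩
  apply Nat.dvd_antisymm
  · exact orderOf_dvd_of_pow_eq_one ((hiff _).mpr dvd_rfl)
  · exact (hiff _).mp (pow_orderOf_eq_one χ)

/-- Composition with an injective ring hom preserves powers of multiplicative characters. -/
theorem ringHomComp_pow {R R' R'' : Type*} [CommMonoid R] [CommRing R'] [CommRing R'']
    (χ : MulChar R R') (f : R' →+* R'') (n : ℕ) :
    (χ ^ n).ringHomComp f = (χ.ringHomComp f) ^ n := by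
  induction n with
  | zero => rw [pow_zero, pow_zero, MulChar.ringHomComp_one]
  | succ n ih => rw [pow_succ, pow_succ, MulChar.ringHomComp_mul, ih]

/-- The `ℂ_p`-valued copy `ι ∘ χ` has the same order as `χ`. [folklore] -/
theorem orderOf_ringHomComp_padicComplex (χ : MulChar (ZMod p) ℚ_[p]) :
    orderOf (χ.ringHomComp (algebraMap ℚ_[p] ℂ_[p])) = orderOf χ := by
  rw [orderOf_eq_orderOf_iff]
  intro n
  rw [← ringHomComp_pow, MulChar.ringHomComp_eq_one_iff (algebraMap ℚ_[p] ℂ_[p]).injective]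

end TeichOrder

/-! ### §5b–c The census locus X4-3: order `e` and the bridge with the order binder discharged -/

section Locus

variable (W : WeierstrassCurve ℚ) [W.IsElliptic] [W.IsGloballyMinimal] (p : ℕ) [hp : Fact p.Prime]

omit [W.IsElliptic] in
/-- **On the X4-3 locus `ω^{t(E,p)}` has exact order `e`**: with `v = v_p(Δ_min)`, `g = gcd(12,v)`,
`e = 12/g ∈ {3,4,6}`, `e ∣ p − 1`: `p − 1 = e d`, `t(E,p) = w d`, `gcd(e, w) = 1`, so
`gcd(p − 1, t) = d` and `(p − 1)/gcd(p − 1, t) = e` (the arithmetic of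
`CensusX43.not_dvd_ordinaryTeichmullerExponent`, sharpened). [folklore] -/
theorem div_gcd_ordinaryTeichmullerExponent_eq
    (he : semistabilityIndex W p ∈ ({3, 4, 6} : Finset ℕ)) (hdvd : semistabilityIndex W p ∣ p - 1) :
    (p - 1) / Nat.gcd (p - 1) (CensusX43.ordinaryTeichmullerExponent W p) =
      semistabilityIndex W p := by
  unfold CensusX43.ordinaryTeichmullerExponent
  unfold semistabilityIndex at he hdvd ⊢
  set v : ℕ := padicValInt p W.minimalDiscriminantInt with hv
  set g : ℕ := Nat.gcd 12 v with hg
  set e : ℕ := 12 / g with hedef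
  have hg12 : g ∣ 12 := Nat.gcd_dvd_left 12 v
  have hgv : g ∣ v := Nat.gcd_dvd_right 12 v
  have hg0 : 0 < g := Nat.gcd_pos_of_pos_left v (by norm_num)
  have heg : e * g = 12 := Nat.div_mul_cancel hg12
  have he2 : 2 ≤ e := by
    simp only [Finset.mem_insert, Finset.mem_singleton] at he
    rcases he with h | h | h <;> omega
  obtain ⟨w, hw⟩ := hgv
  obtain ⟨d, hd⟩ := hdvd
  have hcop : Nat.gcd e w = 1 := by
    have h1 : Nat.gcd (g * e) (g * w) = g * Nat.gcd e w := Nat.gcd_mul_left g e w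
    rw [mul_comm g e, heg, ← hw, ← hg] at h1
    have h2 : g * Nat.gcd e w = g * 1 := by rw [mul_one]; exact h1.symm
    exact Nat.eq_of_mul_eq_mul_left hg0 h2
  have ht : v * (p - 1) / 12 = w * d := by
    rw [hw, hd, show g * w * (e * d) = 12 * (w * d) by rw [← heg]; ring]
    exact Nat.mul_div_cancel_left _ (by norm_num)
  have hd0 : 0 < d := by
    rcases Nat.eq_zero_or_pos d with h0 | h0
    · exfalso; rw [h0, mul_zero] at hd; have := hp.out.two_le; omega
    · exact h0
  rw [ht, hd, show e * d = d * e by ring, show w * d = d * w by ring, Nat.gcd_mul_left, hcop,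
    mul_one, Nat.mul_div_cancel_left _ hd0]

/-- **The bridge on the census locus X4-3** (`p ≥ 5` prime, `(E,p)` in cell (G-ord) with defect
`e ∈ {3,4,6}`): the census's typed modular-forms input `CensusX43.OrdinaryTwistPartnerAt W p`
(Delbourgo's `f̃` with a unit `U_p`-eigenvalue at the prime singled out by `ω^{t(E,p)}`) DELIVERS,
for the newform `f` of `E` and `χ = ω^{t(E,p)}`, an E-normalised tame branch
`IsTameBranchOf f p (ι∘χ) ã B` with `‖ã‖ = 1`, the tame character of order EXACTLY
`e = tameDefect E p` — i.e. precisely the tuple over which the typed main conjecture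
`TameBranchRatCharEqAt W p` (`TameBranchLower.lean`) quantifies — together with the integrality
transfer `‖[r]⁺_f‖_p ≤ C ⟹ ‖[Tⁿ]B‖ ≤ C`. So on X4-3 rows the analytic object of N10's tame-branch
line is not an extra hypothesis beyond the census input. [folklore] -/
theorem exists_isTameBranchOf_of_ordinaryTwistPartnerAt (h5 : 5 ≤ p) (hG : SubGord W p)
    (he : semistabilityIndex W p ∈ ({3, 4, 6} : Finset ℕ))
    (h : CensusX43.OrdinaryTwistPartnerAt W p) {N : ℕ} [NeZero N] {f : CuspForm (Gamma0 N) 2}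
    (hf : IsNewformOf W f) {χ : MulChar (ZMod p) ℚ_[p]}
    (hχ : CensusX43.IsTeichmullerPow χ (CensusX43.ordinaryTeichmullerExponent W p)) :
    ∃ (ã : ℚ_[p]) (B : PowerSeries ℚ_[p]), ‖ã‖ = 1 ∧
      orderOf (χ.ringHomComp (algebraMap ℚ_[p] ℂ_[p])) = tameDefect W p ∧
      IsTameBranchOf f p (χ.ringHomComp (algebraMap ℚ_[p] ℂ_[p])) ã B ∧
      ∀ C : ℝ, (∀ r : ℚ, ‖((ratPlusSymbol f r : ℚ) : ℚ_[p])‖ ≤ C) →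
        ∀ n : ℕ, ‖PowerSeries.coeff n B‖ ≤ C := by
  have hne : χ ≠ 1 := CensusX43.ne_one_of_isTeichmullerPow hχ
    (CensusX43.not_dvd_ordinaryTeichmullerExponent W p h5 he hG.2.2)
  obtain ⟨ã, B, hã, hB, hint⟩ :=
    exists_isTameBranchOf_of_hasOrdinaryTwistPartner hne (h h5 hG he f hf χ hχ)
  refine ⟨ã, B, hã, ?_, hB, hint⟩
  rw [orderOf_ringHomComp_padicComplex, orderOf_eq_of_isTeichmullerPow hχ,
    div_gcd_ordinaryTeichmullerExponent_eq W p he hG.2.2, tameDefect_of_not_potMult W p hG.1]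

end Locus

end Summit.BirchSwinnertonDyer.Rank1Residual.Additive

end
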